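import Summits.NavierStokesRegularity.NavierStokesRegularity.Theses.AdaptedFrequency
import Literature.Analysis.FluidPDE.AdaptedBackwardKernel
import Summits.NavierStokesRegularity.NavierStokesRegularity.Theorems.AdaptedFrequencyAdaptedFrequencyConvergesStubLandau
import Summits.NavierStokesRegularity.NavierStokesRegularity.Theorems.AdaptedFrequencyAdaptedFrequencyConvergesStubPinchingUpper
import Summits.NavierStokesRegularity.NavierStokesRegularity.Theorems.AdaptedFrequencyAdaptedFrequencyConvergesStubPinchingLower
import Summits.NavierStokesRegularity.NavierStokesRegularity.Theorems.AdaptedFrequencyAdaptedFrequencyConvergesStubKernelCalculus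

/-!
# `AdaptedFrequencyConverges` reduces to slow decrease of the adapted frequency over dyadic windows
(crux stmt-NavierStokesRegularity-10493, line `tauberian-omega-limit`, lead's composition)

Sorry-free REDUCTION theorem of the line (lands `--supports stmt-NavierStokesRegularity-10493`):
`adaptedFrequencyConverges_of_slowDecrease` — if, under the crux hypotheses (classical NS on
`ℝ³ × [0,T)`, Leray–Hopf from a rapidly decaying datum, Type-I rate, `(T, x₀)` backward-singular,
`G` a Gaussian-comparable flow-adapted backward kernel on `[t₀, T)`), the adapted frequency
`Λ = adaptedFrequency u G T` is SLOWLY DECREASING over fixed log-time windows at `T`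
(`∀ ε > 0`, eventually `Λ t ≤ Λ t' + ε` whenever `t ≤ t' < T`, `T − t ≤ 2 (T − t')` — the line's only
open stub `stub_slowDecrease`, verbatim as registered), then the crux
`AdaptedFrequency.AdaptedFrequencyConverges` holds, with limit `Λ₀ = 2`.

Proof = the line's composition over its four LANDED stubs (same namespace):
`stub_kernelCalculus` (p90419: `H = adaptedEnstrophy u G` differentiable on `(t₀, T)`),
`stub_pinchingUpper` (p78510: `(T−t)² H ≤ C₁`, Type-I derivative bound), `stub_pinchingLower`
(p82804: `0 < c₀ ≤ (T−t)² H`, Barker–Prange `L³` concentration + Gaussian lower comparability),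
`stub_landau` (p78071: bounded `log((T−t)²H)` + slow decrease ⇒ `(T−t)H′/H → 2`, Landau/Hardy).
Together with the disprover's converse `stub_slowDecrease_of_adaptedFrequencyConverges`
(`Theorems/AdaptedFrequencyConverges/Negative/…`, p84273: a convergent `Λ` is slowly decreasing) this
makes the remaining stub EQUIVALENT to the crux: the line isolates the Navier–Stokes content of
`AdaptedFrequencyConverges` as a one-sided, local-in-log-time Tauberian condition and pins `Λ₀ = 2`.
Sources: Hardy, *Divergent Series* (1949) §6.1 (Landau's one-sided Tauberian theorem); Poon, Comm.
PDE 21 (1996) (parabolic frequency); idea card `Cruxes/AdaptedFrequencyConverges/Ideas/tauberian-omega-limit.md`.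
-/

noncomputable section

namespace Summit.NavierStokesRegularity.NavierStokesRegularity.Theorems.AdaptedFrequencyConverges.TauberianOmegaLimit

open scoped Topology
open Literature.Analysis.FluidPDE Set Filter MeasureTheory
open Summit.NavierStokesRegularity.NavierStokesRegularity.Theses.AdaptedFrequency

/-- **The crux reduces to slow decrease of `Λ` over dyadic windows** (line `tauberian-omega-limit`):
if under the crux hypotheses the adapted frequency drops by at most `ε` across every late window
`t ≤ t' < T` with `T − t ≤ 2 (T − t')` (for every `ε > 0`), then `AdaptedFrequencyConverges` holds
(indeed `Λ → 2`): kernel calculus + two-sided pinching `c₀ ≤ (T−t)² H ≤ C₁` + Landau's one-sided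
Tauberian step, all landed in this namespace. -/
theorem adaptedFrequencyConverges_of_slowDecrease : (∀ (ν T : ℝ) (u : ℝ → EuclideanSpace ℝ (Fin 3) → EuclideanSpace ℝ (Fin 3)) (p : ℝ → EuclideanSpace ℝ (Fin 3) → ℝ) (x₀ : EuclideanSpace ℝ (Fin 3)) (t₀ : ℝ) (G : ℝ → EuclideanSpace ℝ (Fin 3) → ℝ), 0 < ν → 0 < T → IsClassicalNSSolutionOn (Ico 0 T) ν 0 u p → IsLerayHopfOn T ν 0 (u 0) u → HasRapidSpatialDecay (u 0) → IsTypeIBlowup u T → t₀ ∈ Ico 0 T → (∀ r : ℝ, 0 < r → eLpNorm (Function.uncurry u) ⊤ (volume.restrict (parabolicCylinder r (T, x₀))) = ⊤) → IsAdaptedBackwardKernel ν u (Ico t₀ T) T x₀ G → IsGaussianComparable G (Ico t₀ T) T x₀ → ∀ ε : ℝ, 0 < ε → ∃ t₁ : ℝ, t₁ < T ∧ ∀ t t' : ℝ, t₁ ≤ t → t ≤ t' → t' < T → T - t ≤ 2 * (T - t') → adaptedFrequency u G T t ≤ adaptedFrequency u G T t' + ε) → AdaptedFrequencyConverges := by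
  intro hSD ν T hν hT u p hcl hLH hdec hTI x₀ t₀ G ht₀ hsing hK hcomp H Λ hH hΛ
  have hker : IsAdaptedBackwardKernel ν u (Ico t₀ T) T x₀ G := isAdaptedBackwardKernel_iff.2 hK
  have hcmp : IsGaussianComparable G (Ico t₀ T) T x₀ := isGaussianComparable_iff_fin_three.2 hcomp
  -- `H` is the adapted enstrophy, `Λ` the adapted frequency
  have hH' : H = adaptedEnstrophy u G := by
    rw [hH]; funext t; rfl
  have hΛ' : Λ = adaptedFrequency u G T := by
    rw [hΛ, hH']; funext t; rfl
  refine ⟨2, ?_⟩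
  rw [hΛ']
  -- differentiability near `T`
  obtain ⟨t₁, ht₁, hdiff⟩ :=
    stub_kernelCalculus ν T u p x₀ t₀ G hν hT hcl hLH hdec hTI ht₀ hsing hker hcmp
  -- pinching near `T`
  obtain ⟨t₂, ht₂, C₁, hup⟩ :=
    stub_pinchingUpper ν T u p x₀ t₀ G hν hT hcl hLH hdec hTI ht₀ hsing hker hcmp
  obtain ⟨t₂', ht₂', c₀, hc₀, hlow⟩ :=
    stub_pinchingLower ν T u p x₀ t₀ G hν hT hcl hLH hdec hTI ht₀ hsing hker hcmp
  -- slow decrease (the hypothesis)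
  have hsd := hSD ν T u p x₀ t₀ G hν hT hcl hLH hdec hTI ht₀ hsing hker hcmp
  -- a common window `[t₃, T)`
  set t₃ : ℝ := max (max ((t₁ + T) / 2) t₂) t₂' with ht₃
  have ht₃T : t₃ < T := max_lt (max_lt (by linarith [ht₁.2]) ht₂.2) ht₂'.2
  have ht₁₃ : t₁ < t₃ :=
    lt_of_lt_of_le (by linarith [ht₁.2]) ((le_max_left _ _).trans (le_max_left _ _))
  have ht₂₃ : t₂ ≤ t₃ := (le_max_right _ _).trans (le_max_left _ _)
  have ht₂₃' : t₂' ≤ t₃ := le_max_right _ _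
  have hd : ∀ t ∈ Ico t₃ T, DifferentiableAt ℝ (adaptedEnstrophy u G) t := fun t ht =>
    hdiff t ⟨lt_of_lt_of_le ht₁₃ ht.1, ht.2⟩
  have hp : ∃ c₀ C₁ : ℝ, 0 < c₀ ∧ ∀ t ∈ Ico t₃ T,
      c₀ ≤ (T - t) ^ 2 * adaptedEnstrophy u G t ∧ (T - t) ^ 2 * adaptedEnstrophy u G t ≤ C₁ :=
    ⟨c₀, C₁, hc₀, fun t ht =>
      ⟨hlow t ⟨ht₂₃'.trans ht.1, ht.2⟩, hup t ⟨ht₂₃.trans ht.1, ht.2⟩⟩⟩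
  have hsd' : ∀ ε : ℝ, 0 < ε → ∃ t₂ : ℝ, t₂ < T ∧ ∀ t t' : ℝ, t₂ ≤ t → t ≤ t' → t' < T →
      T - t ≤ 2 * (T - t') →
        (T - t) * deriv (adaptedEnstrophy u G) t / adaptedEnstrophy u G t ≤
          (T - t') * deriv (adaptedEnstrophy u G) t' / adaptedEnstrophy u G t' + ε := by
    intro ε hε
    obtain ⟨t₄, ht₄, h⟩ := hsd ε hε
    exact ⟨t₄, ht₄, fun t t' h1 h2 h3 h4 => by
      simpa only [adaptedFrequency_apply] using h t t' h1 h2 h3 h4⟩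
  have hmain := stub_landau T t₃ (adaptedEnstrophy u G) ht₃T hd hp hsd'
  have hfun : adaptedFrequency u G T =
      fun t => (T - t) * deriv (adaptedEnstrophy u G) t / adaptedEnstrophy u G t := by
    funext t; rfl
  rw [hfun]
  exact hmain

end Summit.NavierStokesRegularity.NavierStokesRegularity.Theorems.AdaptedFrequencyConverges.TauberianOmegaLimit

end
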